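import Summits.ValiantsHypothesis.ValiantsHypothesis.Theorems.BarrierLeverChowHitsThinRowPartitionMinorsRefutation
import Summits.ValiantsHypothesis.ValiantsHypothesis.Theorems.BarrierLeverPartitionMinorsHitByVPOfChow
import Summits.ValiantsHypothesis.ValiantsHypothesis.Theorems.BarrierLeverPartitionMinorsHitByVPOfReadOnce

/-!
# Route BarrierLever — REFUTATION of item `ChowHitsReadOnceDeterminants` (stmt-ValiantsHypothesis-20239)

Prover file (cell valiant-natproofs, rung V4, 𝒟-side; seat val-np-p2 gen 9).  **Closes item 20239
NEGATIVELY**: `ChowHitsReadOnceDeterminants` implies CPM (landed arrow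
`PartitionMinorsOfReadOnce.chowHitsPartitionMinors_of_chowHitsReadOnceDeterminants`), CPM implies its
thin-row slice 20195 (landed arrow `ChowGlue.chowHitsThinRowPartitionMinors_of_chowHitsPartitionMinors`,
unfolded here by one line), and 20195 is false (`ChowStarve.not_ChowHitsThinRowPartitionMinors`: the
starved dense-regime layouts kill every product of `h + h` affine forms from `h = 25` on; memo
HOME/val-np-p2/g9/REFUTATION-20195-valnp2-g9.md).

WHAT THIS IS NOT: nothing on items 19717 / 20152, on crux stmt-ValiantsHypothesis-14610, or on
`VP` versus `VNP`.
-/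

set_option linter.dupNamespace false

namespace Summit.ValiantsHypothesis.ValiantsHypothesis.Theorems.BarrierLever.ChowStarve

/-- **Item `ChowHitsReadOnceDeterminants` (stmt-ValiantsHypothesis-20239) is FALSE**: it implies CPM,
whose thin-row slice (item 20195) is false. -/
theorem not_ChowHitsReadOnceDeterminants :
    ¬ Summit.ValiantsHypothesis.ValiantsHypothesis.Theses.BarrierLever.ChowHitsReadOnceDeterminants := by
  intro H
  obtain ⟨h₀, H1⟩ := PartitionMinorsOfReadOnce.chowHitsPartitionMinors_of_chowHitsReadOnceDeterminants H
  exact not_ChowHitsThinRowPartitionMinors ⟨h₀, fun h hh r u w hu hw _ => H1 h hh r u w hu hw⟩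

end Summit.ValiantsHypothesis.ValiantsHypothesis.Theorems.BarrierLever.ChowStarve
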